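import Literature.NumberTheory.Sieve.ElliottHalberstamBridgeProofs
import HarnessLib

/-!
# Route `ChenParityOracleBLAP` — crux S1 = `HostParityFromBrick` (stmt-Parity-20045): the brick on a box

Support file for S1 (`K1 → K2 → HP1 ∧ HP2`).  The two halves of the brick are consumed only through
ONE inequality, proved here: on a box `(M, 2M] × (N, 2N]` of the K-window and for coefficients of
the K-class (1-bounded, supported on `w₀`-rough integers, `w₀ = exp(log x / log log x)`),
`∑_{d ≤ x^{1/2−ε}} |∑∑_{d ∣ mn+h} α_m β_n λ(mn+h)| ≤ (1 + (1 + log x)²) · x/(log x)^A`: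
for odd `d` one adds K2 (class minus own mean) and `φ(d)⁻¹ ×` K1 (the mean), with
`∑_{d ≤ D} 1/φ(d) ≤ (1 + log D)²` (`Literature.NumberTheory.Sieve.sum_Icc_one_div_totient_le_sq`);
for even `d` the inner sum vanishes, since rough `m, n` are odd once `w₀ > 2` and then `mn ± 2` is
odd.  Also: the K-window is monotone in `δ` (`window_mono`), so K1 and K2 may be used with the
common `δ = min δ₁ δ₂`.

References: G. Harman, *Prime-Detecting Sieves* (2007), Ch. 3 (the Type-I/II formalism)
[Harman2007]; Chen Jing-run, Sci. Sinica 16 (1973) [ChenSciSinica1973].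
-/

namespace Summit.Parity.GeneralizedHardyLittlewood.Theorems

open Finset Real

/-- A `w`-rough positive integer is odd once `w > 2` (`2` is then not among its prime factors). -/
theorem odd_of_rough {w : ℝ} (hw : 2 < w) {n : ℕ} (hn : n ≠ 0)
    (h : ∀ p ∈ n.primeFactors, w ≤ p) : Odd n := by
  rcases Nat.even_or_odd n with he | ho
  · exfalso
    have h2 : 2 ∈ n.primeFactors := Nat.mem_primeFactors.mpr ⟨Nat.prime_two, he.two_dvd, hn⟩
    have := h 2 h2
    norm_num at this
    linarith
  · exact ho

/-- For rough `m, n ≥ 1` (w.r.t. some `w > 2`) and `h = ±2`, no even `d` divides `mn + h`. -/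
theorem not_even_dvd_of_rough {w : ℝ} (hw : 2 < w) {m n : ℕ} (hm : m ≠ 0) (hn : n ≠ 0)
    (hmr : ∀ p ∈ m.primeFactors, w ≤ p) (hnr : ∀ p ∈ n.primeFactors, w ≤ p)
    {h : ℤ} (hh : h = 2 ∨ h = -2) {d : ℕ} (hd : Even d) : ¬ ((d : ℤ) ∣ (m : ℤ) * n + h) := by
  intro hdvd
  have hmo : Odd (m : ℤ) := by exact_mod_cast (odd_of_rough hw hm hmr)
  have hno : Odd (n : ℤ) := by exact_mod_cast (odd_of_rough hw hn hnr)
  have hho : Even h := by rcases hh with rfl | rfl <;> decide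
  have hodd : Odd ((m : ℤ) * n + h) := (hmo.mul hno).add_even hho
  have hd' : Even (d : ℤ) := by exact_mod_cast hd
  have heven : Even ((m : ℤ) * n + h) := even_iff_two_dvd.mpr (hd'.two_dvd.trans hdvd)
  exact (Int.not_even_iff_odd.mpr hodd) heven

/-- **Monotonicity of the K-window in `δ`** (`x ≥ 1`): a statement quantified over the boxes of
the `δ`-window (`x^{1/3−δ} ≤ M ≤ x^{1/2}`, `x^{1−δ} ≤ MN ≤ x`) implies the same statement over the
boxes of the `δ'`-window for `δ' ≤ δ` (the `δ'`-window is contained in the `δ`-window). -/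
theorem window_mono {x : ℕ} (hx : 1 ≤ x) {δ δ' : ℝ} (hδ : δ' ≤ δ) (P : ℕ → ℕ → Prop)
    (hP : ∀ M N : ℕ, (x : ℝ) ^ (1 / 3 - δ) ≤ M → (M : ℝ) ≤ (x : ℝ) ^ (1 / 2 : ℝ) →
      (x : ℝ) ^ (1 - δ) ≤ (M : ℝ) * N → (M : ℝ) * N ≤ x → P M N) :
    ∀ M N : ℕ, (x : ℝ) ^ (1 / 3 - δ') ≤ M → (M : ℝ) ≤ (x : ℝ) ^ (1 / 2 : ℝ) →
      (x : ℝ) ^ (1 - δ') ≤ (M : ℝ) * N → (M : ℝ) * N ≤ x → P M N := by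
  intro M N h1 h2 h3 h4
  have hx1 : (1 : ℝ) ≤ x := by exact_mod_cast hx
  refine hP M N (le_trans ?_ h1) h2 (le_trans ?_ h3) h4
  · exact Real.rpow_le_rpow_of_exponent_le hx1 (by linarith)
  · exact Real.rpow_le_rpow_of_exponent_le hx1 (by linarith)

/-- `∑_{d ≤ D} 1/φ(d) ≤ (1 + log x)²` for `D = ⌊x^{1/2−ε}⌋`, `x ≥ 1`, `ε ≥ 0` (from the tree's
`∑_{q ≤ Q} 1/φ(q) ≤ (1 + log Q)²` and `D ≤ x`). -/
theorem sum_inv_totient_level_le {x : ℕ} (hx : 1 ≤ x) {ε : ℝ} (hε : 0 ≤ ε) :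
    ∑ d ∈ Icc 1 ⌊(x : ℝ) ^ (1 / 2 - ε)⌋₊, ((Nat.totient d : ℝ))⁻¹ ≤ (1 + Real.log x) ^ 2 := by
  set D := ⌊(x : ℝ) ^ (1 / 2 - ε)⌋₊ with hD
  have hx1 : (1 : ℝ) ≤ x := by exact_mod_cast hx
  have h1 := Literature.NumberTheory.Sieve.sum_Icc_one_div_totient_le_sq D
  have hDx : (D : ℝ) ≤ x := by
    calc (D : ℝ) ≤ (x : ℝ) ^ (1 / 2 - ε) := Nat.floor_le (by positivity)
      _ ≤ (x : ℝ) ^ (1 : ℝ) := Real.rpow_le_rpow_of_exponent_le hx1 (by linarith)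
      _ = x := Real.rpow_one _
  have hlogD : Real.log D ≤ Real.log x := by
    rcases Nat.eq_zero_or_pos D with hD0 | hD0
    · rw [hD0, Nat.cast_zero, Real.log_zero]; exact Real.log_nonneg hx1
    · exact Real.log_le_log (by exact_mod_cast hD0) hDx
  have hlogD0 : 0 ≤ Real.log D := by
    rcases Nat.eq_zero_or_pos D with hD0 | hD0
    · rw [hD0, Nat.cast_zero, Real.log_zero]
    · exact Real.log_nonneg (by exact_mod_cast hD0)
  calc ∑ d ∈ Icc 1 D, ((Nat.totient d : ℝ))⁻¹ = ∑ d ∈ Icc 1 D, (1 : ℝ) / Nat.totient d := by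
        simp [one_div]
    _ ≤ (1 + Real.log D) ^ 2 := h1
    _ ≤ (1 + Real.log x) ^ 2 := by gcongr

/-- **The brick on a box.**  For `x` with `w₀(x) = exp(log x/log log x) > 2`: if K1 holds at `x`
on the `δ`-window with saving `A` (hypothesis `hK1`) and K2 holds at `x` on the `δ`-window at level
`x^{1/2−ε}` with saving `A` (hypothesis `hK2`), then for every box `(M, 2M] × (N, 2N]` of the
window, all coefficients of the K-class and `h = ±2`,
`∑_{1 ≤ d ≤ x^{1/2−ε}} |∑_{m ∼ M} ∑_{n ∼ N, d ∣ mn+h} α_m β_n λ(mn+h)| ≤ (1 + (1 + log x)²) · x/(log x)^A`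
(odd `d`: K2 plus `φ(d)⁻¹ ·` K1; even `d`: the inner sum is empty). -/
theorem brick_box_sum_le {x : ℕ} (hx : 1 ≤ x) {δ ε A : ℝ} (hε : 0 ≤ ε)
    (hw : 2 < Real.exp (Real.log x / Real.log (Real.log x)))
    (hK1 : ∀ M N : ℕ, (x : ℝ) ^ (1 / 3 - δ) ≤ M → (M : ℝ) ≤ (x : ℝ) ^ (1 / 2 : ℝ) →
      (x : ℝ) ^ (1 - δ) ≤ (M : ℝ) * N → (M : ℝ) * N ≤ x → ∀ α β : ℕ → ℝ, (∀ n, |α n| ≤ 1) →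
      (∀ n, |β n| ≤ 1) →
      (∀ n, α n ≠ 0 → ∀ p ∈ n.primeFactors, Real.exp (Real.log x / Real.log (Real.log x)) ≤ p) →
      (∀ n, β n ≠ 0 → ∀ p ∈ n.primeFactors, Real.exp (Real.log x / Real.log (Real.log x)) ≤ p) →
      ∀ h : ℤ, (h = 2 ∨ h = -2) →
      |∑ m ∈ Finset.Ioc M (2 * M), ∑ n ∈ Finset.Ioc N (2 * N),
        α m * β n * (ArithmeticFunction.liouville (Int.toNat ((m : ℤ) * n + h)) : ℝ)| ≤
        (x : ℝ) / Real.log x ^ A)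
    (hK2 : ∀ M N : ℕ, (x : ℝ) ^ (1 / 3 - δ) ≤ M → (M : ℝ) ≤ (x : ℝ) ^ (1 / 2 : ℝ) →
      (x : ℝ) ^ (1 - δ) ≤ (M : ℝ) * N → (M : ℝ) * N ≤ x → ∀ α β : ℕ → ℝ, (∀ n, |α n| ≤ 1) →
      (∀ n, |β n| ≤ 1) →
      (∀ n, α n ≠ 0 → ∀ p ∈ n.primeFactors, Real.exp (Real.log x / Real.log (Real.log x)) ≤ p) →
      (∀ n, β n ≠ 0 → ∀ p ∈ n.primeFactors, Real.exp (Real.log x / Real.log (Real.log x)) ≤ p) →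
      ∀ h : ℤ, (h = 2 ∨ h = -2) →
      (∑ d ∈ (Finset.Icc 1 ⌊(x : ℝ) ^ (1 / 2 - ε)⌋₊).filter (fun d : ℕ => Odd d),
        |(∑ m ∈ Finset.Ioc M (2 * M), ∑ n ∈ (Finset.Ioc N (2 * N)).filter
            (fun n : ℕ => (d : ℤ) ∣ (m : ℤ) * n + h),
            α m * β n * (ArithmeticFunction.liouville (Int.toNat ((m : ℤ) * n + h)) : ℝ)) -
          (Nat.totient d : ℝ)⁻¹ * ∑ m ∈ Finset.Ioc M (2 * M), ∑ n ∈ Finset.Ioc N (2 * N),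
            α m * β n * (ArithmeticFunction.liouville (Int.toNat ((m : ℤ) * n + h)) : ℝ)|) ≤
        (x : ℝ) / Real.log x ^ A)
    {M N : ℕ} (hM1 : (x : ℝ) ^ (1 / 3 - δ) ≤ M) (hM2 : (M : ℝ) ≤ (x : ℝ) ^ (1 / 2 : ℝ))
    (hMN1 : (x : ℝ) ^ (1 - δ) ≤ (M : ℝ) * N) (hMN2 : (M : ℝ) * N ≤ x)
    {α β : ℕ → ℝ} (hα : ∀ n, |α n| ≤ 1) (hβ : ∀ n, |β n| ≤ 1)
    (hαs : ∀ n, α n ≠ 0 → ∀ p ∈ n.primeFactors, Real.exp (Real.log x / Real.log (Real.log x)) ≤ p)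
    (hβs : ∀ n, β n ≠ 0 → ∀ p ∈ n.primeFactors, Real.exp (Real.log x / Real.log (Real.log x)) ≤ p)
    {h : ℤ} (hh : h = 2 ∨ h = -2) :
    ∑ d ∈ Finset.Icc 1 ⌊(x : ℝ) ^ (1 / 2 - ε)⌋₊,
      |∑ m ∈ Finset.Ioc M (2 * M), ∑ n ∈ (Finset.Ioc N (2 * N)).filter
          (fun n : ℕ => (d : ℤ) ∣ (m : ℤ) * n + h),
          α m * β n * (ArithmeticFunction.liouville (Int.toNat ((m : ℤ) * n + h)) : ℝ)| ≤
      (1 + (1 + Real.log x) ^ 2) * ((x : ℝ) / Real.log x ^ A) := by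
  set D := ⌊(x : ℝ) ^ (1 / 2 - ε)⌋₊ with hD
  set w := Real.exp (Real.log x / Real.log (Real.log x)) with hw_def
  -- the full (unfiltered) box sum and the class sums
  set S : ℝ := ∑ m ∈ Finset.Ioc M (2 * M), ∑ n ∈ Finset.Ioc N (2 * N),
      α m * β n * (ArithmeticFunction.liouville (Int.toNat ((m : ℤ) * n + h)) : ℝ) with hS
  set Sd : ℕ → ℝ := fun d => ∑ m ∈ Finset.Ioc M (2 * M), ∑ n ∈ (Finset.Ioc N (2 * N)).filter
      (fun n : ℕ => (d : ℤ) ∣ (m : ℤ) * n + h),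
      α m * β n * (ArithmeticFunction.liouville (Int.toNat ((m : ℤ) * n + h)) : ℝ) with hSd
  have hB0 : 0 ≤ (x : ℝ) / Real.log x ^ A := by
    have hl : 0 ≤ Real.log x := Real.log_nonneg (by exact_mod_cast hx)
    positivity
  have h1 : |S| ≤ (x : ℝ) / Real.log x ^ A := hK1 M N hM1 hM2 hMN1 hMN2 α β hα hβ hαs hβs h hh
  have h2 := hK2 M N hM1 hM2 hMN1 hMN2 α β hα hβ hαs hβs h hh
  -- even `d`: the inner sum vanishes
  have heven : ∀ d ∈ (Finset.Icc 1 D).filter (fun d : ℕ => ¬ Odd d), |Sd d| = 0 := by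
    intro d hd
    rw [Finset.mem_filter, Nat.not_odd_iff_even] at hd
    rw [abs_eq_zero, hSd]
    refine Finset.sum_eq_zero fun m hm => Finset.sum_eq_zero fun n hn => ?_
    rw [Finset.mem_filter] at hn
    by_cases hαm : α m = 0
    · rw [hαm]; ring
    by_cases hβn : β n = 0
    · rw [hβn]; ring
    exfalso
    have hm0 : m ≠ 0 := by have := (Finset.mem_Ioc.mp hm).1; omega
    have hn0 : n ≠ 0 := by have := (Finset.mem_Ioc.mp hn.1).1; omega
    exact not_even_dvd_of_rough hw hm0 hn0 (hαs m hαm) (hβs n hβn) hh hd.2 hn.2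
  -- odd `d`: K2 + φ(d)⁻¹ K1
  have hodd : ∑ d ∈ (Finset.Icc 1 D).filter (fun d : ℕ => Odd d), |Sd d| ≤
      (x : ℝ) / Real.log x ^ A + (1 + Real.log x) ^ 2 * ((x : ℝ) / Real.log x ^ A) := by
    have hpt : ∀ d ∈ (Finset.Icc 1 D).filter (fun d : ℕ => Odd d),
        |Sd d| ≤ |Sd d - (Nat.totient d : ℝ)⁻¹ * S| + (Nat.totient d : ℝ)⁻¹ * |S| := by
      intro d _
      have hφ : 0 ≤ (Nat.totient d : ℝ)⁻¹ := inv_nonneg.mpr (Nat.cast_nonneg _)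
      calc |Sd d| = |(Sd d - (Nat.totient d : ℝ)⁻¹ * S) + (Nat.totient d : ℝ)⁻¹ * S| := by ring_nf
        _ ≤ |Sd d - (Nat.totient d : ℝ)⁻¹ * S| + |(Nat.totient d : ℝ)⁻¹ * S| := abs_add_le _ _
        _ = _ := by rw [abs_mul, abs_of_nonneg hφ]
    calc ∑ d ∈ (Finset.Icc 1 D).filter (fun d : ℕ => Odd d), |Sd d|
        ≤ ∑ d ∈ (Finset.Icc 1 D).filter (fun d : ℕ => Odd d),
            (|Sd d - (Nat.totient d : ℝ)⁻¹ * S| + (Nat.totient d : ℝ)⁻¹ * |S|) := Finset.sum_le_sum hpt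
      _ = (∑ d ∈ (Finset.Icc 1 D).filter (fun d : ℕ => Odd d), |Sd d - (Nat.totient d : ℝ)⁻¹ * S|) +
            (∑ d ∈ (Finset.Icc 1 D).filter (fun d : ℕ => Odd d), (Nat.totient d : ℝ)⁻¹) * |S| := by
          rw [Finset.sum_add_distrib, Finset.sum_mul]
      _ ≤ (x : ℝ) / Real.log x ^ A + (∑ d ∈ Finset.Icc 1 D, (Nat.totient d : ℝ)⁻¹) *
            ((x : ℝ) / Real.log x ^ A) := by
          refine add_le_add h2 (mul_le_mul ?_ h1 (abs_nonneg _) ?_)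
          · refine Finset.sum_le_sum_of_subset_of_nonneg (Finset.filter_subset _ _) ?_
            intro d _ _; exact inv_nonneg.mpr (Nat.cast_nonneg _)
          · exact Finset.sum_nonneg fun d _ => inv_nonneg.mpr (Nat.cast_nonneg _)
      _ ≤ (x : ℝ) / Real.log x ^ A + (1 + Real.log x) ^ 2 * ((x : ℝ) / Real.log x ^ A) := by
          gcongr
          exact sum_inv_totient_level_le hx hε
  -- assemble
  have hsplit := (Finset.sum_filter_add_sum_filter_not (Finset.Icc 1 D) (fun d : ℕ => Odd d)
    (fun d => |Sd d|)).symm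
  calc ∑ d ∈ Finset.Icc 1 D, |Sd d|
      = (∑ d ∈ (Finset.Icc 1 D).filter (fun d : ℕ => Odd d), |Sd d|) +
          ∑ d ∈ (Finset.Icc 1 D).filter (fun d : ℕ => ¬ Odd d), |Sd d| := hsplit
    _ = ∑ d ∈ (Finset.Icc 1 D).filter (fun d : ℕ => Odd d), |Sd d| := by
        rw [Finset.sum_eq_zero heven, add_zero]
    _ ≤ (x : ℝ) / Real.log x ^ A + (1 + Real.log x) ^ 2 * ((x : ℝ) / Real.log x ^ A) := hodd
    _ = (1 + (1 + Real.log x) ^ 2) * ((x : ℝ) / Real.log x ^ A) := by ring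

end Summit.Parity.GeneralizedHardyLittlewood.Theorems
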